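import Mathlib
import HarnessLib
import Summits.PneNP.PneNP.Theorems.CnfIdealGenLengthRankCount
import Summits.PneNP.PneNP.Theorems.CnfIdealGenLengthFregeShortensGenLength
import Summits.PneNP.PneNP.Theorems.CnfIdealGenLengthRankDefectRepresentationsExactification
import Summits.PneNP.PneNP.Theorems.CnfIdealGenLengthRankDefectRepresentationsPhantomTransfer

/-!
# Crux `RankDefectRepresentations` (stmt-PneNP-18923): the Frege ceiling PER FAMILY (negative tool)

The sharp form of the ceiling (lead prover, 2026-08-27), usable by refuters against CONCRETE candidate families: for a
sound rule list `F` there is a constant `K` such that an `F`-refutation of `φ` (an `F`-proof of `¬ ofCNF φ`) of size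
`≤ s` forces, at EVERY almost-representation `M` with axiom ranks `≤ t` over any field of characteristic `0`,
`rank P_φ(M) ≤ K s³ · t` (`rank_clauseProduct_le_of_fregeProof`) and `dim U ≤ K s³ · t` for every subspace `U`
killed by the clause words of `φ` (`finrank_phantom_le_of_fregeProof`).  Assembled from `proofRepr` (p540918 chain),
`trForm_neg_ofCNF`, `hasBoundedRepr_of_repr`, `rank_clauseProduct_le_of_hasBoundedRepr` (p541615) and the peeling
lemma (p577876).  Consequence: every Frege-easy family — pigeonhole principles (Buss), parity / Tseitin / linear
systems (Gaussian elimination in Frege), 2-CNF, Horn — is DEAD as a witness family for the crux and for the hard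
stub S1 of the line `phantom-kernel`, quantitatively.  HONEST FRAMING: bookkeeping over landed theorems; P ≠ NP is
not moved; F-N2 is a FRONTIER formal rung.
-/

set_option linter.dupNamespace false -- `Summit.PneNP.PneNP.…`: summit = sub-problem name (D-0017)

namespace Summit.PneNP.PneNP.Theorems.CnfIdealGenLength

open Filter
open Literature.Computability.Complexity
open Literature.Computability.MetaComplexity
open Literature.Computability.MetaComplexity.NCIPS

/-- **Frege ceiling per family (clause-product rank).** For a sound `F` there is `K` with: an `F`-proof of
`¬ ofCNF φ` of size `≤ s` (`φ` over `n ≥ 1` variables) forces `rank P_φ(M) ≤ K s³ · t` at every tuple `M` in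
characteristic `0` whose Boolean/commutator axioms have rank `≤ t`. [folklore] -/
theorem rank_clauseProduct_le_of_fregeProof (F : FregeSystem) (hF : F.IsSound) :
    ∃ K : ℕ, ∀ (n : ℕ), 0 < n → ∀ (φ : CNF (Fin n)) (π : List (PropForm ℕ)) (s : ℕ),
      F.IsProofOf π (PropForm.neg (PropForm.ofCNF (φ.map fun κ => κ.map fun l => (l.1.val, l.2)))) →
      proofSize π ≤ s →
      ∀ (L : Type) [Field L] [CharZero L] (d t : ℕ) (M : Fin n → Matrix (Fin d) (Fin d) L),
        (∀ g : MonoidAlgebra L (FreeMonoid (Fin n)), IsAxiom g →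
          (MonoidAlgebra.lift L (Matrix (Fin d) (Fin d) L) (FreeMonoid (Fin n)) (FreeMonoid.lift M) g).rank ≤ t) →
        (MonoidAlgebra.lift L (Matrix (Fin d) (Fin d) L) (FreeMonoid (Fin n)) (FreeMonoid.lift M)
          (clauseProduct L φ)).rank ≤ K * s ^ 3 * t := by
  obtain ⟨K, hK⟩ := proofRepr (R := ℚ) F hF
  refine ⟨K, fun n hn φ π s hπ hs L _ _ d t M hax => ?_⟩
  have h := hK n π _ s hπ hs
  rw [trForm_neg_ofCNF] at h
  have hb : HasBoundedRepr ℚ (K * s ^ 2 + K * s) (K * s ^ 3) φ := hasBoundedRepr_of_repr hn h le_rfl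
  exact rank_clauseProduct_le_of_hasBoundedRepr M hax hb

/-- **Frege ceiling per family (phantoms).** Same hypotheses: every subspace `U` killed by the clause words of `φ` at
`M` has `dim U ≤ K s³ · t`.  Every Frege-easy CNF family is dead for the hard stub `stub_contradictoryPhantoms`.
[folklore] -/
theorem finrank_phantom_le_of_fregeProof (F : FregeSystem) (hF : F.IsSound) :
    ∃ K : ℕ, ∀ (n : ℕ), 0 < n → ∀ (φ : CNF (Fin n)) (π : List (PropForm ℕ)) (s : ℕ),
      F.IsProofOf π (PropForm.neg (PropForm.ofCNF (φ.map fun κ => κ.map fun l => (l.1.val, l.2)))) →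
      proofSize π ≤ s →
      ∀ (L : Type) [Field L] [CharZero L] (d t : ℕ) (M : Fin n → Matrix (Fin d) (Fin d) L),
        (∀ g : MonoidAlgebra L (FreeMonoid (Fin n)), IsAxiom g →
          (MonoidAlgebra.lift L (Matrix (Fin d) (Fin d) L) (FreeMonoid (Fin n)) (FreeMonoid.lift M) g).rank ≤ t) →
        ∀ U : Submodule L (Fin d → L),
          (∀ κ ∈ φ, ∀ x ∈ U, (MonoidAlgebra.lift L (Matrix (Fin d) (Fin d) L) (FreeMonoid (Fin n))
            (FreeMonoid.lift M) (clauseWord L κ)).mulVec x = 0) →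
          Module.finrank L U ≤ K * s ^ 3 * t := by
  obtain ⟨K, hK⟩ := rank_clauseProduct_le_of_fregeProof F hF
  refine ⟨K, fun n hn φ π s hπ hs L _ _ d t M hax U hU => ?_⟩
  have hle : U ≤ ⨅ κ ∈ φ, LinearMap.ker (Matrix.toLin'
      (MonoidAlgebra.lift L (Matrix (Fin d) (Fin d) L) (FreeMonoid (Fin n)) (FreeMonoid.lift M) (clauseWord L κ))) :=
    fun x hx => (mem_iInf_ker_clauseWord_iff M φ x).mpr fun κ hκ => hU κ hκ x hx
  exact (Submodule.finrank_mono hle).trans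
    ((finrank_iInf_ker_le_rank_clauseProduct M φ).trans (hK n hn φ π s hπ hs L d t M hax))

end Summit.PneNP.PneNP.Theorems.CnfIdealGenLength
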